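import Mathlib
import Literature.Analysis.FluidPDE.CriticalSpaces
import Summits.NavierStokesRegularity.NavierStokesRegularity.Theorems.AxisymmetricExtremalityMinimalDatumPFoldOfSymmGap

/-!
# Sketch (crux-ideate, ideator 2, round 1) — crux `MinimalDatumPFold` (stmt-NavierStokesRegularity-15452)

First lemmas of two idea cards, typed over existing declarations:

* card `large-p-collapse`: `AngularBesovCollapse` (high discrete rotational symmetry forces
  Besov-smallness of the non-axisymmetric part), `AxisymGapClosing` (the transfer target C⁺:
  ρ_ax = ρ_max in infimum form), `PFoldInfimumCollapse` (the converse: p_j-fold cheap blow-up for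
  p_j → ∞ forces axisymmetric cheap blow-up), and the kernel-checked transfer
  `minimalDatumPFold_of_axisymGapClosing : AxisymGapClosing → MinimalDatumPFold`.
* card `dissipation-maximiser-branch`: the total critical dissipation `totalDissipation ν u₀`
  (`J`), `SubthresholdDissipationBound`, `DissipationDivergence`, `NearMaximisersToMinimal`,
  `AxisymDissipationUnbounded` and the glue `axisymDissipationUnbounded_of_branch`.
-/

noncomputable section

set_option linter.dupNamespace false

open MeasureTheory Set Function Filter Topology TemperedDistribution
open scoped ENNReal NNReal SchwartzMap

namespace Summit.NavierStokesRegularity.NavierStokesRegularity.Cruxes.MinimalDatumPFold.Ideator2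

local notation "ℝ³" => EuclideanSpace ℝ (Fin 3)
local notation "ℂ³" => EuclideanSpace ℂ (Fin 3)

open Literature.Analysis.FluidPDE Literature.Analysis.FunctionSpaces

/-! ## Common vocabulary -/

/-- The rotation `R_θ` about the `x₂`-axis, written out exactly as in the route file
(definitionally `Literature.Analysis.FluidPDE.rotZ`). -/
def rot (θ : ℝ) (x : ℝ³) : ℝ³ :=
  WithLp.toLp 2 ![Real.cos θ * x 0 - Real.sin θ * x 1, Real.sin θ * x 0 + Real.cos θ * x 1, x 2]

/-- Clay (A) fails at viscosity `ν` (verbatim the antecedent of the crux). -/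
def ClayFails (ν : ℝ) : Prop :=
  ∃ v₀ : ℝ³ → ℝ³, ContDiff ℝ (⊤ : ℕ∞) v₀ ∧ NSWave0.IsDivFree v₀ ∧ HasRapidSpatialDecay v₀ ∧
    ¬ ∃ (u : ℝ → ℝ³ → ℝ³) (p : ℝ → ℝ³ → ℝ), IsSmoothOnHalfSpace u ∧ IsSmoothOnHalfSpace p ∧
      IsNavierStokesSolution ν 0 v₀ u p ∧ HasBoundedEnergy u

/-- A blow-up datum of viscosity `ν`: an `L³` field represented in `Ḣ^{1/2}`, weakly
divergence-free, with no global Kato solution (the first, second, third and fifth clause of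
`IsMinimalBlowupDatum`). -/
def IsBlowupDatum (ν : ℝ) (u₀ : ℝ³ → ℝ³) (g : HomSobolev ℝ³ ℂ³ (1 / 2 : ℝ)) : Prop :=
  MemLp u₀ 3 (volume : Measure ℝ³) ∧ g.Represents (EuclideanSpace.complexify ∘ u₀) ∧
    IsWeaklyDivFree u₀ ∧ ¬ HasGlobalKatoSolution ν u₀

/-- a.e. equivariance under `R_{2π/p}` (the symmetry clause of `stub_symmGapClosing`). -/
def IsAePFold (p : ℕ) (u₀ : ℝ³ → ℝ³) : Prop :=
  ∀ᵐ x ∂(volume : Measure ℝ³), u₀ (rot (2 * Real.pi / p) x) = rot (2 * Real.pi / p) (u₀ x)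

/-- a.e. axisymmetry about the `x₂`-axis: equivariance under every `R_θ`, each a.e. -/
def IsAeAxisym (u₀ : ℝ³ → ℝ³) : Prop :=
  ∀ θ : ℝ, ∀ᵐ x ∂(volume : Measure ℝ³), u₀ (rot θ x) = rot θ (u₀ x)

/-- The azimuthal (`SO(2)_{e₃}`-) average of a vector field: the orthogonal projection onto
axisymmetric fields, `(A u)(x) = (2π)⁻¹ ∫₀^{2π} R_{-θ} u(R_θ x) dθ`. -/
def azAvg (u : ℝ³ → ℝ³) (x : ℝ³) : ℝ³ :=
  (2 * Real.pi)⁻¹ • ∫ θ in (0 : ℝ)..(2 * Real.pi), rot (-θ) (u (rot θ x))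

/-! ## Card `large-p-collapse` -/

/-- **Angular Besov collapse** (first lemma of card `large-p-collapse`; harmonic analysis, new):
for every `δ > 0` there is `p₀` such that for `p ≥ p₀` the non-axisymmetric part `u - A u` of ANY
a.e. `R_{2π/p}`-equivariant `L³` field represented by `g ∈ Ḣ^{1/2}` has
`‖u - A u‖_{Ḃ^{-1}_{∞,∞}} ≤ δ ‖g‖_{Ḣ^{1/2}}`. (Proof sketch: `e^{Δ}(u - Au)(x₀) = ⟨u, Q_p G_{x₀}⟩`
with `Q_p` = Z_p-average minus SO(2)-average; `sup_{x₀} ‖Q_p G_{x₀}‖_{Ḣ^{-1/2}} ≲ (log p / p)^{1/2}`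
by the trapezoidal-rule error for `θ ↦ G(x - R_θ x₀)` when `dist(x₀, axis) ≤ p / (C log p)` and by
the `|∇|⁻¹`-kernel bound `(1/p²) Σ_{k,l} (1 + |R^k x₀ - R^l x₀|²)⁻¹ ≲ 1/p` otherwise.) -/
def AngularBesovCollapse : Prop :=
  ∀ δ : ℝ, 0 < δ → ∃ p₀ : ℕ, ∀ p : ℕ, p₀ ≤ p →
    ∀ (u : ℝ³ → ℝ³) (g : HomSobolev ℝ³ ℂ³ (1 / 2 : ℝ)) (U : 𝓢'(ℝ³, ℂ³)),
      MemLp u 3 (volume : Measure ℝ³) → g.Represents (EuclideanSpace.complexify ∘ u) →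
      IsAePFold p u → IsDistributionOf (u - azAvg u) U →
      eHomBesovNorm (-1) ∞ ∞ U ≤ ENNReal.ofReal δ * ‖g‖ₑ

/-- **C⁺ = axisymmetric gap closing** (`ρ_ax = ρ_max`, infimum form): Clay failure at `ν` ⇒ for
every `ε > 0` an a.e.-axisymmetric blow-up datum of norm `< ρ_max^pure(ν) + ε`. -/
def AxisymGapClosing : Prop :=
  ∀ ν : ℝ, 0 < ν → ClayFails ν → ∀ ε : ℝ≥0∞, 0 < ε →
    ∃ (u₀ : ℝ³ → ℝ³) (g : HomSobolev ℝ³ ℂ³ (1 / 2 : ℝ)),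
      IsBlowupDatum ν u₀ g ∧ ‖g‖ₑ < rusinSverakRhoMaxPure ν + ε ∧ IsAeAxisym u₀

/-- The registered open stub `stub_symmGapClosing` of line `symmetric-gap`, in this file's
vocabulary (definitionally the registered signature). -/
def SymmGapClosing : Prop :=
  ∀ ν : ℝ, 0 < ν → ClayFails ν → ∀ N : ℕ, ∃ p : ℕ, N ≤ p ∧ 2 ≤ p ∧ ∀ ε : ℝ≥0∞, 0 < ε →
    ∃ (u₀ : ℝ³ → ℝ³) (g : HomSobolev ℝ³ ℂ³ (1 / 2 : ℝ)),
      MemLp u₀ 3 (volume : Measure ℝ³) ∧ g.Represents (EuclideanSpace.complexify ∘ u₀) ∧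
      IsWeaklyDivFree u₀ ∧ ¬ HasGlobalKatoSolution ν u₀ ∧
      ‖g‖ₑ < rusinSverakRhoMaxPure ν + ε ∧ IsAePFold p u₀

/-- **Transfer, trivial direction (kernel-checked): axisymmetric gap closing implies the open stub**
— an a.e.-axisymmetric datum is a.e. `R_{2π/p}`-equivariant for every `p`; take `p := max N 2`. -/
theorem symmGapClosing_of_axisymGapClosing (h : AxisymGapClosing) : SymmGapClosing := by
  intro ν hν hclay N
  refine ⟨max N 2, le_max_left _ _, le_max_right _ _, fun ε hε => ?_⟩
  obtain ⟨u₀, g, ⟨h3, hrep, hdiv, hns⟩, hlt, hax⟩ := h ν hν hclay ε hε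
  exact ⟨u₀, g, h3, hrep, hdiv, hns, hlt, hax _⟩

/-- **Transfer certificate: `AxisymGapClosing → MinimalDatumPFold`** (the crux BY NAME), composing
the trivial direction with the LANDED reduction `minimalDatumPFold_of_symmGapClosing` (p152445). -/
theorem minimalDatumPFold_of_axisymGapClosing (h : AxisymGapClosing) :
    Summit.NavierStokesRegularity.NavierStokesRegularity.Theses.AxisymmetricExtremality.MinimalDatumPFold :=
  Summit.NavierStokesRegularity.NavierStokesRegularity.Theorems.minimalDatumPFold_of_symmGapClosing
    (symmGapClosing_of_axisymGapClosing h)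

/-- **The converse (content) direction of the collapse** (second stub of card `large-p-collapse`,
provable from `AngularBesovCollapse` + Gérard/Gallagher profile decomposition in `Ḣ^{1/2}` +
Gallagher–Koch–Planchon 2013 Thm. 3 + "non-zero profiles of axisymmetric sequences are axisymmetric"):
if for some `p_j → ∞` there are a.e. `R_{2π/p_j}`-equivariant blow-up data of norm `< ρ_max + ε`,
then there is an a.e.-AXISYMMETRIC blow-up datum of norm `≤ ρ_max + ε`. With the trivial direction
this makes `stub_symmGapClosing` EQUIVALENT to `AxisymGapClosing`: p carries no slack. -/
def PFoldInfimumCollapse : Prop :=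
  ∀ ν : ℝ, 0 < ν → rusinSverakRhoMaxPure ν < ⊤ → ∀ ε : ℝ≥0∞, 0 < ε →
    (∀ N : ℕ, ∃ p : ℕ, N ≤ p ∧ ∃ (u₀ : ℝ³ → ℝ³) (g : HomSobolev ℝ³ ℂ³ (1 / 2 : ℝ)),
        IsBlowupDatum ν u₀ g ∧ ‖g‖ₑ < rusinSverakRhoMaxPure ν + ε ∧ IsAePFold p u₀) →
    ∃ (u₀ : ℝ³ → ℝ³) (g : HomSobolev ℝ³ ℂ³ (1 / 2 : ℝ)),
      IsBlowupDatum ν u₀ g ∧ ‖g‖ₑ ≤ rusinSverakRhoMaxPure ν + ε ∧ IsAeAxisym u₀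

/-- Bookkeeping (kernel-checked): the collapse turns the registered stub into axisymmetric gap
closing (`≤ ρ + ε` for all `ε` gives `< ρ + ε'` for all `ε'`), given finiteness of the threshold
under Clay failure (landed: `stub_thresholdFinite_of_clayFailure`, p147201). -/
theorem axisymGapClosing_of_collapse (hC : PFoldInfimumCollapse)
    (hfin : ∀ ν : ℝ, 0 < ν → ClayFails ν → rusinSverakRhoMaxPure ν < ⊤)
    (hS : SymmGapClosing) : AxisymGapClosing := by
  intro ν hν hclay ε hε
  have hρ := hfin ν hν hclay
  -- use ε/2 in the stub, then the collapse, then ≤ ρ + ε/2 < ρ + ε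
  have hε2 : (0 : ℝ≥0∞) < ε / 2 := ENNReal.half_pos hε.ne'
  have key : ∀ N : ℕ, ∃ p : ℕ, N ≤ p ∧ ∃ (u₀ : ℝ³ → ℝ³) (g : HomSobolev ℝ³ ℂ³ (1 / 2 : ℝ)),
      IsBlowupDatum ν u₀ g ∧ ‖g‖ₑ < rusinSverakRhoMaxPure ν + ε / 2 ∧ IsAePFold p u₀ := by
    intro N
    obtain ⟨p, hNp, -, hp⟩ := hS ν hν hclay N
    obtain ⟨u₀, g, h3, hrep, hdiv, hns, hlt, hsym⟩ := hp (ε / 2) hε2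
    exact ⟨p, hNp, u₀, g, ⟨h3, hrep, hdiv, hns⟩, hlt, hsym⟩
  obtain ⟨u₀, g, hB, hle, hax⟩ := hC ν hν hρ (ε / 2) hε2 key
  refine ⟨u₀, g, hB, ?_, hax⟩
  by_cases hεt : ε = ⊤
  · subst hεt
    simpa using (show (‖g‖ₑ : ℝ≥0∞) < ⊤ from enorm_lt_top)
  · exact lt_of_le_of_lt hle (ENNReal.add_lt_add_left hρ.ne (ENNReal.half_lt_self hε.ne' hεt))

/-! ## Card `dissipation-maximiser-branch` -/

/-- **Total critical dissipation** `J(ν, u₀) = ∫₀^∞ ‖u(t)‖²_{Ḣ^{3/2}} dt` of the global Kato solution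
of `u₀` (infimum over global Kato solutions `u` — unique by `kato_unique` — and over families
`G t ∈ Ḣ^{1/2}` representing the slices `u t`; Fourier side `∫ ‖ξ‖³ |G_t(ξ)|² dξ`, the class
`G t ∈ L²(‖ξ‖ dξ)`); junk/true value `⊤` when `u₀` has no global Kato solution. For a global
solution decaying in `Ḣ^{1/2}` one has the identity `‖u₀‖²_{Ḣ^{1/2}} = 2ν J(u₀) + 2 N(u₀)`,
`N(u₀) = ∫₀^∞ ⟨(u·∇)u, |∇|u⟩ dt` (the cumulative nonlinear transfer of the critical norm). -/
def totalDissipation (ν : ℝ) (u₀ : ℝ³ → ℝ³) : ℝ≥0∞ :=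
  ⨅ (u : ℝ → ℝ³ → ℝ³) (G : ℝ → HomSobolev ℝ³ ℂ³ (1 / 2 : ℝ))
    (_ : IsGlobalMildSolution ν 0 u₀ u ∧ ContinuousInLpOn (Ici 0) 3 u ∧ u 0 = u₀ ∧
      AEStronglyMeasurable (uncurry u) ((volume : Measure ℝ).restrict (Ioi 0) |>.prod volume) ∧
      ∀ t : ℝ, 0 ≤ t → (G t).Represents (EuclideanSpace.complexify ∘ u t)),
    ∫⁻ t in Ioi (0 : ℝ), ∫⁻ ξ : ℝ³, ‖ξ‖ₑ ^ (3 : ℝ) *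
      ‖((HomSobolev.toLp (1 / 2 : ℝ) (G t) : Lp ℂ³ 2 (homSobolevMeasure ℝ³ (1 / 2 : ℝ))) : ℝ³ → ℂ³) ξ‖ₑ ^ 2

/-- The sub-threshold dissipation profile `S(ν, r) = sup {J(ν,u₀) : ‖u₀‖_{Ḣ^{1/2}} ≤ r}`. -/
def dissipationSup (ν : ℝ) (r : ℝ≥0∞) : ℝ≥0∞ :=
  ⨆ (u₀ : ℝ³ → ℝ³) (g : HomSobolev ℝ³ ℂ³ (1 / 2 : ℝ))
    (_ : MemLp u₀ 3 (volume : Measure ℝ³) ∧ g.Represents (EuclideanSpace.complexify ∘ u₀) ∧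
      IsWeaklyDivFree u₀ ∧ ‖g‖ₑ ≤ r), totalDissipation ν u₀

/-- The same supremum restricted to a.e.-axisymmetric data, `S_ax(ν, r)`. -/
def dissipationSupAxisym (ν : ℝ) (r : ℝ≥0∞) : ℝ≥0∞ :=
  ⨆ (u₀ : ℝ³ → ℝ³) (g : HomSobolev ℝ³ ℂ³ (1 / 2 : ℝ))
    (_ : MemLp u₀ 3 (volume : Measure ℝ³) ∧ g.Represents (EuclideanSpace.complexify ∘ u₀) ∧
      IsWeaklyDivFree u₀ ∧ ‖g‖ₑ ≤ r ∧ IsAeAxisym u₀), totalDissipation ν u₀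

/-- **First lemma of card `dissipation-maximiser-branch` (provable from the literature: Gallagher
2001 Thm. 2 / Gallagher–Koch–Planchon 2013 Thm. 3, all profiles below `ρ_max` are global ⇒ uniform
spacetime bound):** strictly below the pure threshold the total dissipation is uniformly bounded. -/
def SubthresholdDissipationBound : Prop :=
  ∀ ν : ℝ, 0 < ν → ∀ r : ℝ≥0∞, r < rusinSverakRhoMaxPure ν → dissipationSup ν r < ⊤

/-- **Dissipation diverges on radial approach to a minimal datum** (stability of global Kato
solutions with finite dissipation, GKP 2013 Thm. 3 / Gallagher–Iftimie–Planchon 2003): for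
`(u₀, g) ∈ M` the global data `(1 - 1/(n+2)) • u₀` have `J → ⊤`; hence `S(ν, r) → ⊤` as `r ↑ ρ_max`. -/
def DissipationDivergence : Prop :=
  ∀ ν : ℝ, 0 < ν → ∀ (u₀ : ℝ³ → ℝ³) (g : HomSobolev ℝ³ ℂ³ (1 / 2 : ℝ)),
    IsMinimalBlowupDatum ν u₀ g →
      Tendsto (fun n : ℕ => totalDissipation ν ((1 - ((n : ℝ) + 2)⁻¹) • u₀)) atTop (𝓝 ⊤)

/-- **Near-maximisers converge to minimal blow-up data** (profile decomposition: a sequence with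
`‖g_n‖ ≤ r_n ↑ ρ_max` and `J(u₀ⁿ) → ⊤` has, modulo `Sim` and along a subsequence, an `L³`-limit in
`M` — the variational shadow selects a distinguished closed `Sim ⋊ O(3)`-invariant subset
`M_J ⊆ M`). -/
def NearMaximisersToMinimal : Prop :=
  ∀ ν : ℝ, 0 < ν → rusinSverakRhoMaxPure ν < ⊤ →
    ∀ (U : ℕ → ℝ³ → ℝ³) (G : ℕ → HomSobolev ℝ³ ℂ³ (1 / 2 : ℝ)),
      (∀ n, MemLp (U n) 3 (volume : Measure ℝ³) ∧ (G n).Represents (EuclideanSpace.complexify ∘ U n) ∧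
        IsWeaklyDivFree (U n) ∧ ‖G n‖ₑ < rusinSverakRhoMaxPure ν) →
      Tendsto (fun n => totalDissipation ν (U n)) atTop (𝓝 ⊤) →
      ∃ (lam : ℕ → ℝ) (x₀ : ℕ → ℝ³) (φ : ℕ → ℕ) (u : ℝ³ → ℝ³) (g : HomSobolev ℝ³ ℂ³ (1 / 2 : ℝ)),
        (∀ j, 0 < lam j) ∧ StrictMono φ ∧ IsMinimalBlowupDatum ν u g ∧
        Tendsto (fun j => eLpNorm (rescaleData (lam j) (fun x => U (φ j) (x - x₀ j)) - u) 3
          (volume : Measure ℝ³)) atTop (𝓝 0)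

/-- **The open core of card `dissipation-maximiser-branch`, global-side form of `ρ_ax = ρ_max`:**
under Clay failure the AXISYMMETRIC sub-threshold dissipation is already unbounded at the general
threshold, `S_ax(ν, r) → ⊤` as `r ↑ ρ_max^pure(ν)` (a statement about global smooth solutions only). -/
def AxisymDissipationUnbounded : Prop :=
  ∀ ν : ℝ, 0 < ν → ClayFails ν →
    ⨆ (r : ℝ≥0∞) (_ : r < rusinSverakRhoMaxPure ν), dissipationSupAxisym ν r = ⊤

/-- **The continuation bet** (output of "no symmetry-breaking along the `J_r`-maximiser branch"):
for `r` arbitrarily close to `ρ_max` there are a.e.-axisymmetric near-maximisers of `J` on the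
`r`-ball (within `1` of the supremum; any fixed slack works). -/
def AxisymNearMaximisers : Prop :=
  ∀ ν : ℝ, 0 < ν → ClayFails ν → ∀ r : ℝ≥0∞, r < rusinSverakRhoMaxPure ν →
    ∃ r' : ℝ≥0∞, r ≤ r' ∧ r' < rusinSverakRhoMaxPure ν ∧
      ∃ (u₀ : ℝ³ → ℝ³) (g : HomSobolev ℝ³ ℂ³ (1 / 2 : ℝ)),
        MemLp u₀ 3 (volume : Measure ℝ³) ∧ g.Represents (EuclideanSpace.complexify ∘ u₀) ∧
        IsWeaklyDivFree u₀ ∧ ‖g‖ₑ ≤ r' ∧ IsAeAxisym u₀ ∧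
        dissipationSup ν r' ≤ totalDissipation ν u₀ + 1

/-- Glue (kernel-checked): axisymmetric near-maximisers + divergence of `S(ν, ·)` at the threshold
give `AxisymDissipationUnbounded`. The divergence is taken here in the form
`⨆_{r < ρ_max} S(ν, r) = ⊤` (a consequence of `DissipationDivergence` + Rusin–Šverák `M ≠ ∅`). -/
theorem axisymDissipationUnbounded_of_branch (hB : AxisymNearMaximisers)
    (hdiv : ∀ ν : ℝ, 0 < ν → ClayFails ν →
      ⨆ (r : ℝ≥0∞) (_ : r < rusinSverakRhoMaxPure ν), dissipationSup ν r = ⊤) :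
    AxisymDissipationUnbounded := by
  intro ν hν hclay
  have htop := hdiv ν hν hclay
  -- `⊤ = ⨆_r S(ν,r) ≤ (⨆_{r'} S_ax(ν,r')) + 1`, hence `⨆_{r'} S_ax(ν,r') = ⊤`.
  have hbound : (⨆ (r : ℝ≥0∞) (_ : r < rusinSverakRhoMaxPure ν), dissipationSup ν r) ≤
      (⨆ (r : ℝ≥0∞) (_ : r < rusinSverakRhoMaxPure ν), dissipationSupAxisym ν r) + 1 := by
    refine iSup₂_le fun s hs => ?_
    obtain ⟨s', hss', hs', v₀, w, h3', hrep', hdv', hle', hax', hnear'⟩ := hB ν hν hclay s hs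
    calc dissipationSup ν s ≤ dissipationSup ν s' := by
          unfold dissipationSup
          refine iSup₂_le fun v w' => iSup_le fun hw => ?_
          exact le_iSup₂_of_le v w' (le_iSup_of_le ⟨hw.1, hw.2.1, hw.2.2.1, hw.2.2.2.trans hss'⟩ le_rfl)
      _ ≤ totalDissipation ν v₀ + 1 := hnear'
      _ ≤ dissipationSupAxisym ν s' + 1 := by
          gcongr
          unfold dissipationSupAxisym
          exact le_iSup₂_of_le v₀ w (le_iSup_of_le ⟨h3', hrep', hdv', hle', hax'⟩ le_rfl)
      _ ≤ (⨆ (r : ℝ≥0∞) (_ : r < rusinSverakRhoMaxPure ν), dissipationSupAxisym ν r) + 1 := by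
          gcongr
          exact le_iSup₂_of_le s' hs' le_rfl
  rw [htop, top_le_iff, ENNReal.add_eq_top] at hbound
  rcases hbound with h | h
  · exact h
  · exact absurd h ENNReal.one_ne_top

end Summit.NavierStokesRegularity.NavierStokesRegularity.Cruxes.MinimalDatumPFold.Ideator2
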